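import Summits.QuantumFields.BalabanUV.Beta.GAN24.RelInvWardPairing

/-!
# `BalabanUV.Beta.GAN24.WardPairingCoarse` — binder row G-an2-4 ∕ (CONV-C), W-slot CT-W, the (DL) question Q-g30-1 of the OWNER gan24-p1 g30's
# RULING R-gan24p1-g30-1 (vi) ∕ `QRCC-STATUS` v0.3 §5–§8: **«PAIR-COARSE» — THE MULTIPLIER WORD OF THE RELATIVE-INVERSE WARD PAIRING READS A
# PURE-GAUGE INSERTION THROUGH ONE COARSE SUMMATION BY PARTS: `Σ'_y Σ_κ 𝒬_N(dφ)_κ(y)·M_κ(y) = Σ'_y (blockSum_N φ)(y)·(codiff₁ M)(y)`,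
# WITH ITS TWO-CURRENCY BOUNDS, AND THE WARD PAIRING OF A BLOCK-CONSTANT GAUGE INSERTION IN CLOSED FORM**
# (G-an2-4 formalisation swarm → CRUX TEAM (2), leaf prover `b2b-balaban-gan24-formalise-leaf-03`, gen 63; OFFER O-leaf03-g63-1, the OWNER's WORD W4
# [GAN24P1-G30-W4] «PAIR-COARSE — WANTED … GO, THIS SHAPE» (journal `CLAIMS.log` 2026-08-22); name PROVISIONAL — the row owner ∕ an2 may rename or re-home it)

NOT IN PRINT; OUR BOOKKEEPING ([folklore] lattice exterior calculus on `ℤ^{d+1}`: `AffineAveraging.contourSum_dz` (the straight-contour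
block sum INTERTWINES `d`: `𝒬_N ∘ d = d ∘ blockSum_N`), `KKTFluctuationEnergy.lip0_codiff₁ ∕ lip1_dz` (`d` and `codiff₁` are adjoint between a
bounded and a summable form), dominated `tsum`s, over leaf-06 g46's `RelInvWardPairing.ward_pairing` BY NAME; generic `d`; 0 `def`, 0 cited
facts, 0 `def … : Prop`, 0 sorry).  HONEST FRAMING (cell contract, verbatim): «discharging `BetaPertH` makes Bałaban's UV stability
UNCONDITIONAL — a real constructive-QFT result; it is NOT the continuum limit and NOT the Clay problem.»  HONEST DEPENDENCY (verbatim):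
«continuum YM on T⁴ ⇐ BetaPertH ∧ nine spine estimates (0/9 proved); BetaPertH ⇐ (D1) ∧ (D4) ∧ CAP+tail; G-an2-4 gates asym, D1 and NE2/3/4.»

## Why
`RelInvWardPairing.ward_pairing` (leaf-06 g46): `⟨(d*d)m, (G∘W)^F_{x,b}⟩ = ⟨m, W^F_{x,b}⟩ + Σ'_y Σ_κ (𝒬_N m)_κ(y)·(G∘W)(N•y) x (inr κ) b` for `m` bounded and
zero on the comb bonds — the MULTIPLIER WORD reads `m` only through `𝒬_N m = contourSum N m` against the multiplier column at block BASE POINTS; an2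
g41 W4: the β-row consumes a double-layer component `(∇φ) ⊗ h` of the dressed table through such words.  The OWNER's Q-g30-1 («can the (CONV-C) read
absorb `≍ Lc^{1.5–2}` per level?») is then a COUNT on the multiplier column once the word is written BY PARTS on the coarse lattice — this file (W-2 (D);
the OWNER W4 (2)–(3): «ONE coarse summation by parts buys at most ONE power of `Lc` per level, iff the column's coarse divergence is `Lc⁻¹ ×` itself»).

## What (generic `d`; `N` the relative blocking)
* §1 **`tsum_contourSum_dz_mul_eq`** (block sums of `φ` BOUNDED, column `M` SUMMABLE) ∕ **`tsum_contourSum_dz_mul_eq'`** (block sums SUMMABLE,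
  column BOUNDED): `Σ'_y Σ_κ contourSum N (dz φ) κ y·M κ y = Σ'_y blockSum N φ y·codiff₁ M y` (`codiff₁ M y = Σ_κ (M κ (y − e_κ) − M κ y)` = minus
  the coarse divergence — `AffineAveraging.codiff₁`).
* §2 TWO CURRENCIES: **`abs_tsum_contourSum_dz_mul_le_sup_mul_mass`** (`≤ B_φ·Σ'_y |codiff₁ M y|` — sup of the block sums × ℓ¹-mass of the
  column's coarse divergence) ∕ **`abs_tsum_contourSum_dz_mul_le_mass_mul_sup`** (`≤ (Σ'_y |blockSum N φ y|)·D` for `|codiff₁ M| ≤ D`).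
* §3 IN `RelInvWardPairing`'s CURRENCY: `summable_abs_col_zsmul` (a decaying kernel's column read at the dilated points `N•y` is absolutely
  summable in `y`), **`multiplierWord_dz_eq`** ∕ **`abs_multiplierWord_dz_le`** — §1∕§2 at `M κ y := V (N•y) x (inr κ) b`, `V` spread (e.g.
  `V = G ∘ W`).
* §4 THE BLOCK-CONSTANT GAUGE INSERTION: for `φ = ψ ∘ blk N` (`ψ` a bounded COARSE potential) `dz φ` vanishes on every comb bond (comb bonds are
  intra-block) and `blockSum N φ = N^{d+1}·ψ`, so `ward_pairing` gives the CLOSED FORM **`ward_pairing_dz_blk`**: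
  `Σ'_u Σ_κ dz (ψ ∘ blk N) κ u·W u x (inl κ) b = −(N^{d+1}·Σ'_y ψ y·codiff₁ (κ y ↦ (G∘W)(N•y) x (inr κ) b) y)` — THE BARE TABLE READS A
  BLOCK-CONSTANT GAUGE INSERTION AS `N^{d+1} ×` (the coarse potential) × (the coarse CODIFFERENTIAL of the relative inverse's multiplier
  column); **`abs_tableWord_dz_blk_le`** its sup × mass bound; **`ward_pairing_dz_blk_coDressKBmAt_KInvStep_zero`** the instance
  `G₀ = coDressKBmAt (toSite r) Lc (KInvStep Lc 0)` (leaf-06's §4 socket).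
* §5 THE LAW (§4 at the indicator potential `ψ = 𝟙_{y₀}`, whose lifted gauge `dz (𝟙_{y₀} ∘ blk N)` is an2's `gaugeWt N y₀`): `tsum_dz_blockInd_mul_eq_blockSum_codiff₁`
  (`Σ'_u Σ_κ dz (𝟙_{y₀}∘blk N) κ u·w κ u = blockSum N (codiff₁ w) y₀`, finite support) ⟹ **`pow_mul_codiff₁_multiplierCol_eq`**:
  `N^{d+1}·codiff₁ (κ y ↦ (G∘W)(N•y) x (inr κ) b) y₀ = −blockSum N (codiff₁ (κ u ↦ W u x (inl κ) b)) y₀` — THE COARSE CODIFFERENTIAL OF THE RELATIVE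
  INVERSE's MULTIPLIER COLUMN IS (MINUS) THE BLOCK MEAN OF THE TABLE COLUMN's FINE CODIFFERENTIAL, exactly, for every relative inverse and every
  spread table; corollaries **`multiplierWord_dz_eq_zero_of_coclosed`** (a CO-CLOSED table column makes the multiplier word of EVERY pure gauge
  vanish) and **`pow_mul_abs_codiff₁_multiplierCol_le`** (the ℓ¹ count: `N^{d+1}·|codiff₁ (mult. col.) y₀| ≤ Σ_{v∈box} |codiff₁ (table col.) (N•y₀+v)|`).

LOCATED CAVEAT (honest): identities and Hölder bounds only.  §5 answers «is the multiplier column coarse-smooth?» IN FORM — it is exactly as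
coarse-smooth as the table column is co-closed on block average (one fine divergence of `W`, averaged; NO extra power of `Lc` from the
coarse-graining itself) — and asserts NO size of `codiff₁ W^F` for an2's literal tables; that number is the count Q-g30-1 now reduces to
(the OWNER W4 (3)).  NOTE (leaf-01 g69 W-1, located): `codiff₁ (κ u ↦ W u x (inl κ) b)` is the codifferential of the KERNEL `W` in its
ROW (fine field-bond) index at a fixed column — Ward covariance of the table in its first kernel index — NOT the slot divergence
`KernelWard.divV S` of a slot family (row (CC)'s «co-closed letter»); for the born Wilson kernel at a fixed slot it is the CONTACT law
(finitely supported near the slot, nonzero — the OWNER's E35), so «co-closed ⟹ the word vanishes» concerns kernels Ward-covariant in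
their row index, and which divergence the consumer's tables present in that index is the consumer's assembly, not decided here.
Decides nothing about (Q-R) ∕ (DIV) ∕ (DL) ∕ K-LL-4′; NOTHING of (LT) ∕ (LAY) ∕ (S) ∕ «T2Shape» ∕ «T2Drift» ∕ (hW, hWall) discharged; 0 wall
binders; NEVER «G-an2-4 closed» as (CONV-C); NOT D1, NOT `BetaPertH`, NOT continuum, NOT Clay; not in print — our bookkeeping.  Unit
`b2b-balaban-gan24-formalise-leaf-03` (gen 63), 2026-08-22; no existing file touched.
-/

noncomputable section

open Finset
open scoped BigOperators
open Literature.MathematicalPhysics.QuantumFieldTheory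
open Literature.MathematicalPhysics.QuantumFieldTheory.Balaban1983to89
open Literature.MathematicalPhysics.QuantumFieldTheory.Balaban1983to89.Beta
open B12Sec2to5 (l1 l1_nonneg)
open ExpKernelCalculus (MKer Decays comp summable_exp_shift')
open AffineAveraging (Form0 Form1 box toSite unitVec dz curv curvAdj codiff₁ blockSum contourSum contourSum_dz curv_dz)
open AveragingContours (blk blk_block)
open KKTFluctuationEnergy (lip0 lip1 lip0_codiff₁ lip1_dz summable_mul_of_bdd summable_shift_sub)
open OneStepResolventKernel (Fib)
open OneStepKernelFamily (KInvStep)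
open Summit.QuantumFields.BalabanUV.Beta.TameKernelCalculus
open Summit.QuantumFields.BalabanUV.Beta.ChartConjugationRelative (RelInv spr_comp)
open Summit.QuantumFields.BalabanUV.Beta.AxialDressingRooted (IsCombBondAt axEc coDressKBmAt spr_coDressKBmAt one_le_of_neZero)
open Summit.QuantumFields.BalabanUV.Beta.BorderedHessian (bhK relInv_coDressKBmAt_KInvStep_zero)
open Summit.QuantumFields.BalabanUV.Beta.GAN24.RelInvWardPairing (ward_pairing summable_bdd_mul)

namespace Summit.QuantumFields.BalabanUV.Beta.GAN24.WardPairingCoarse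

variable {d : ℕ}

/-! ## §1 The contour word of a pure gauge, by parts on the coarse lattice -/

section ByParts

variable {N : ℕ} {φ : Form0 (d + 1) ℝ} {M : Form1 (d + 1) ℝ} {B D : ℝ}

/-- [folklore] The coarse codifferential of a 1-form with summable components is summable. -/
theorem summable_codiff₁ (hM : ∀ κ, Summable (M κ)) : Summable (codiff₁ M) := by
  have h : Summable fun y => ∑ κ, (M κ (y - unitVec κ) - M κ y) :=
    summable_sum fun κ _ => (summable_shift_sub (hM κ) (unitVec κ)).sub (hM κ)
  exact h.congr fun y => by simp [AffineAveraging.codiff₁]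

/-- [folklore] … and absolutely summable when the components are. -/
theorem summable_abs_codiff₁ (hM : ∀ κ, Summable fun y => |M κ y|) : Summable fun y => |codiff₁ M y| := by
  have hsh : ∀ κ, Summable fun y => |M κ (y - unitVec κ)| := fun κ => (Equiv.subRight (unitVec κ)).summable_iff.2 (hM κ)
  have hmaj : Summable fun y : Fin (d + 1) → ℤ => ∑ κ : Fin (d + 1), (|M κ (y - unitVec κ)| + |M κ y|) :=
    summable_sum (s := Finset.univ) fun κ _ => (hsh κ).add (hM κ)
  refine Summable.of_nonneg_of_le (fun y => abs_nonneg _) (fun y => ?_) hmaj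
  simp only [AffineAveraging.codiff₁]
  refine (Finset.abs_sum_le_sum_abs _ _).trans (Finset.sum_le_sum fun κ _ => ?_)
  exact abs_sub _ _

/-- NOT IN PRINT; OUR BOOKKEEPING (`contourSum_dz` ⨾ `lip0_codiff₁`).  **THE CONTOUR WORD OF A PURE GAUGE BY PARTS** — block sums of the potential BOUNDED, column SUMMABLE:
`Σ'_y Σ_κ contourSum N (dz φ) κ y·M κ y = Σ'_y blockSum N φ y·codiff₁ M y`. -/
theorem tsum_contourSum_dz_mul_eq (hφ : ∀ y, |blockSum N φ y| ≤ B) (hM : ∀ κ, Summable (M κ)) :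
    ∑' y, ∑ κ, contourSum N (dz φ) κ y * M κ y = ∑' y, blockSum N φ y * codiff₁ M y := by
  rw [contourSum_dz]
  have h := lip0_codiff₁ hφ hM
  unfold KKTFluctuationEnergy.lip0 KKTFluctuationEnergy.lip1 at h
  exact h.symm

/-- NOT IN PRINT; OUR BOOKKEEPING (`contourSum_dz` ⨾ `lip1_dz`).  **THE SAME, block sums of the potential SUMMABLE, column BOUNDED.** -/
theorem tsum_contourSum_dz_mul_eq' (hφ : Summable (blockSum N φ)) (hM : ∀ κ y, |M κ y| ≤ D) :
    ∑' y, ∑ κ, contourSum N (dz φ) κ y * M κ y = ∑' y, blockSum N φ y * codiff₁ M y := by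
  rw [contourSum_dz]
  have h := lip1_dz hM hφ
  unfold KKTFluctuationEnergy.lip0 KKTFluctuationEnergy.lip1 at h
  have e1 : (fun y => ∑ κ, dz (blockSum N φ) κ y * M κ y) = fun y => ∑ κ, M κ y * dz (blockSum N φ) κ y := by
    funext y; exact Finset.sum_congr rfl fun κ _ => mul_comm _ _
  have e2 : (fun y => blockSum N φ y * codiff₁ M y) = fun y => codiff₁ M y * blockSum N φ y := by
    funext y; exact mul_comm _ _
  rw [e1, e2]
  exact h

/-! ## §2 The two currencies -/

/-- NOT IN PRINT; OUR BOOKKEEPING.  **SUP × MASS**: block sums of the potential bounded by `B`, column absolutely summable ⟹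
`|Σ'_y Σ_κ contourSum N (dz φ) κ y·M κ y| ≤ B·Σ'_y |codiff₁ M y|` — the word is controlled by the ℓ¹-MASS OF THE COLUMN's COARSE DIVERGENCE. -/
theorem abs_tsum_contourSum_dz_mul_le_sup_mul_mass (hφ : ∀ y, |blockSum N φ y| ≤ B) (hM : ∀ κ, Summable fun y => |M κ y|) :
    |∑' y, ∑ κ, contourSum N (dz φ) κ y * M κ y| ≤ B * ∑' y, |codiff₁ M y| := by
  have hM' : ∀ κ, Summable (M κ) := fun κ => (hM κ).of_abs
  rw [tsum_contourSum_dz_mul_eq hφ hM']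
  have hs : Summable fun y => |codiff₁ M y| := summable_abs_codiff₁ hM
  have hb := tsum_of_norm_bounded (hs.mul_left B).hasSum (f := fun y => blockSum N φ y * codiff₁ M y) (fun y => by
    rw [Real.norm_eq_abs, abs_mul]
    exact mul_le_mul_of_nonneg_right (hφ y) (abs_nonneg _))
  rw [Real.norm_eq_abs, tsum_mul_left] at hb
  exact hb

/-- NOT IN PRINT; OUR BOOKKEEPING.  **MASS × SUP**: block sums of the potential absolutely summable, column bounded with `|codiff₁ M| ≤ D` ⟹
`|Σ'_y Σ_κ contourSum N (dz φ) κ y·M κ y| ≤ (Σ'_y |blockSum N φ y|)·D`. -/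
theorem abs_tsum_contourSum_dz_mul_le_mass_mul_sup (hφ : Summable fun y => |blockSum N φ y|) (hM : ∀ κ y, |M κ y| ≤ B)
    (hD : ∀ y, |codiff₁ M y| ≤ D) :
    |∑' y, ∑ κ, contourSum N (dz φ) κ y * M κ y| ≤ (∑' y, |blockSum N φ y|) * D := by
  rw [tsum_contourSum_dz_mul_eq' hφ.of_abs hM]
  have hb := tsum_of_norm_bounded (hφ.mul_right D).hasSum (f := fun y => blockSum N φ y * codiff₁ M y) (fun y => by
    rw [Real.norm_eq_abs, abs_mul]
    exact mul_le_mul_of_nonneg_left (hD y) (abs_nonneg _))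
  rw [Real.norm_eq_abs, tsum_mul_right] at hb
  exact hb

end ByParts

/-! ## §3 In `RelInvWardPairing`'s currency: the multiplier column of a spread kernel -/

section Column

variable {N : ℕ} {V : MKer (d + 1) (Fib d)} {C δ : ℝ}

/-- [folklore] A decaying kernel's column read at the dilated points `N•y` (`N ≥ 1`) is absolutely summable in the coarse variable `y`
(the dilation is injective; comparison with `e^{−δ‖·−x‖₁}`). -/
theorem summable_abs_col_zsmul (hV : Decays V C δ) (hδ : 0 < δ) (hN : 1 ≤ N) (x : Fin (d + 1) → ℤ) (a b : Fib d) :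
    Summable fun y : Fin (d + 1) → ℤ => |V ((N : ℤ) • y) x a b| := by
  have hinj : Function.Injective (fun y : Fin (d + 1) → ℤ => (N : ℤ) • y) := by
    have hN0 : (N : ℤ) ≠ 0 := by exact_mod_cast Nat.one_le_iff_ne_zero.1 hN
    exact smul_right_injective (Fin (d + 1) → ℤ) hN0
  have hmaj : Summable fun y : Fin (d + 1) → ℤ => C * Real.exp (-δ * l1 ((N : ℤ) • y - x)) :=
    (((summable_exp_shift' hδ x).comp_injective hinj).mul_left C).congr fun y => rfl
  exact Summable.of_nonneg_of_le (fun y => abs_nonneg _) (fun y => hV _ _ a b) hmaj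

/-- NOT IN PRINT; OUR BOOKKEEPING (§1 at the multiplier column).  **THE MULTIPLIER WORD OF A PURE GAUGE, BY PARTS**: `V` decaying (e.g. `V = G ∘ W` spread), `N ≥ 1`,
block sums of `φ` bounded ⟹ `Σ'_y Σ_κ contourSum N (dz φ) κ y·V (N•y) x (inr κ) b = Σ'_y blockSum N φ y·codiff₁ (κ y ↦ V (N•y) x (inr κ) b) y`. -/
theorem multiplierWord_dz_eq (hV : Decays V C δ) (hδ : 0 < δ) (hN : 1 ≤ N) {φ : Form0 (d + 1) ℝ} {B : ℝ} (hφ : ∀ y, |blockSum N φ y| ≤ B)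
    (x : Fin (d + 1) → ℤ) (b : Fib d) :
    ∑' y, ∑ κ, contourSum N (dz φ) κ y * V ((N : ℤ) • y) x (Sum.inr κ) b
      = ∑' y, blockSum N φ y * codiff₁ (fun κ y => V ((N : ℤ) • y) x (Sum.inr κ) b) y :=
  tsum_contourSum_dz_mul_eq (M := fun κ y => V ((N : ℤ) • y) x (Sum.inr κ) b) hφ
    (fun κ => (summable_abs_col_zsmul hV hδ hN x (Sum.inr κ) b).of_abs)

/-- NOT IN PRINT; OUR BOOKKEEPING (§2 at the multiplier column).  **SUP × MASS FOR THE MULTIPLIER WORD**: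
`|Σ'_y Σ_κ contourSum N (dz φ) κ y·V (N•y) x (inr κ) b| ≤ B·Σ'_y |codiff₁ (κ y ↦ V (N•y) x (inr κ) b) y|`. -/
theorem abs_multiplierWord_dz_le (hV : Decays V C δ) (hδ : 0 < δ) (hN : 1 ≤ N) {φ : Form0 (d + 1) ℝ} {B : ℝ} (hφ : ∀ y, |blockSum N φ y| ≤ B)
    (x : Fin (d + 1) → ℤ) (b : Fib d) :
    |∑' y, ∑ κ, contourSum N (dz φ) κ y * V ((N : ℤ) • y) x (Sum.inr κ) b|
      ≤ B * ∑' y, |codiff₁ (fun κ y => V ((N : ℤ) • y) x (Sum.inr κ) b) y| :=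
  abs_tsum_contourSum_dz_mul_le_sup_mul_mass (M := fun κ y => V ((N : ℤ) • y) x (Sum.inr κ) b) hφ
    (fun κ => summable_abs_col_zsmul hV hδ hN x (Sum.inr κ) b)

end Column

/-! ## §4 The Ward pairing of a block-constant gauge insertion -/

section BlockConstant

variable {N : ℕ}

/-- [folklore] Comb bonds are intra-block, so the gauge of a BLOCK-CONSTANT potential vanishes on them. -/
theorem dz_comp_blk_eq_zero_of_isCombBondAt {ρ : Fin (d + 1) → ℤ} (ψ : Form0 (d + 1) ℝ) {κ : Fin (d + 1)} {u : Fin (d + 1) → ℤ}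
    (h : IsCombBondAt ρ N κ u) : dz (fun v => ψ (blk N v)) κ u = 0 := by
  simp only [AffineAveraging.dz, h.2, sub_self]

/-- [folklore] The gauge of a bounded block-constant potential is bounded (by `2B`). -/
theorem abs_dz_comp_blk_le {ψ : Form0 (d + 1) ℝ} {B : ℝ} (hψ : ∀ y, |ψ y| ≤ B) (κ : Fin (d + 1)) (u : Fin (d + 1) → ℤ) :
    |dz (fun v => ψ (blk N v)) κ u| ≤ B + B := by
  simp only [AffineAveraging.dz]
  exact (abs_sub _ _).trans (add_le_add (hψ _) (hψ _))

/-- [folklore] The block sum of a block-constant potential: `blockSum N (ψ ∘ blk N) y = N^{d+1}·ψ y`. -/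
theorem blockSum_comp_blk (ψ : Form0 (d + 1) ℝ) (y : Fin (d + 1) → ℤ) :
    blockSum N (fun v => ψ (blk N v)) y = ((N : ℝ) ^ (d + 1)) * ψ y := by
  simp only [AffineAveraging.blockSum]
  rw [Finset.sum_congr rfl (fun b hb => by rw [blk_block y hb]), Finset.sum_const]
  have hcard : (box (d + 1) N).card = N ^ (d + 1) := by
    simp [AffineAveraging.box, Fintype.card_piFinset, Finset.card_range, Finset.prod_const, Finset.card_univ, Fintype.card_fin]
  rw [hcard, nsmul_eq_mul]
  push_cast
  ring

/-- [folklore] `d*d` annihilates every exact 1-form: `curvAdj (curv (dz φ)) = 0`. -/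
theorem curvAdj_curv_dz (φ : Form0 (d + 1) ℝ) : curvAdj (curv (dz φ)) = 0 := by
  rw [curv_dz]
  funext μ y
  simp [AffineAveraging.curvAdj]

/-- NOT IN PRINT; OUR BOOKKEEPING (`ward_pairing` at `m := dz (ψ ∘ blk N)` ⨾ §3 ⨾ `blockSum_comp_blk`).  **THE WARD PAIRING OF A BLOCK-CONSTANT GAUGE INSERTION,
CLOSED FORM**: `RelInv G (bhK N) (axEc ρ N)`, `G`, `W` spread, `ψ` a bounded coarse potential; then for every `(x, b)`
`Σ'_u Σ_κ dz (ψ ∘ blk N) κ u·W u x (inl κ) b = −(N^{d+1}·Σ'_y ψ y·codiff₁ (κ y ↦ (G∘W)(N•y) x (inr κ) b) y)` — the bare table's field column reads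
the insertion as `N^{d+1} ×` the coarse potential against the coarse CODIFFERENTIAL of the relative inverse's multiplier column (the `(d*d)`-side
vanishes identically: `d ∘ d = 0`). -/
theorem ward_pairing_dz_blk [NeZero N] {ρ : Fin (d + 1) → ℤ} {G W : MKer (d + 1) (Fib d)}
    (hG : RelInv G (bhK N) (axEc ρ N)) (hGs : Spr G) (hWs : Spr W) {ψ : Form0 (d + 1) ℝ} {B : ℝ} (hψ : ∀ y, |ψ y| ≤ B)
    (x : Fin (d + 1) → ℤ) (b : Fib d) :
    ∑' u, ∑ κ, dz (fun v => ψ (blk N v)) κ u * W u x (Sum.inl κ) b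
      = -(((N : ℝ) ^ (d + 1)) * ∑' y, ψ y * codiff₁ (fun κ y => comp G W ((N : ℤ) • y) x (Sum.inr κ) b) y) := by
  have hN : 1 ≤ N := one_le_of_neZero N
  obtain ⟨C, δ, hδ, hVd⟩ := spr_comp hGs hWs
  have h := ward_pairing hG hGs hWs (m := dz (fun v => ψ (blk N v))) (abs_dz_comp_blk_le hψ)
    (fun κ u hc => dz_comp_blk_eq_zero_of_isCombBondAt ψ hc) x b
  have h0 : ∑' u, ∑ κ, curvAdj (curv (dz (fun v => ψ (blk N v)))) κ u * comp G W u x (Sum.inl κ) b = 0 := by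
    simp [curvAdj_curv_dz]
  rw [h0] at h
  have hφ : ∀ y, |blockSum N (fun v => ψ (blk N v)) y| ≤ ((N : ℝ) ^ (d + 1)) * B := fun y => by
    rw [blockSum_comp_blk, abs_mul, abs_of_nonneg (by positivity)]
    exact mul_le_mul_of_nonneg_left (hψ y) (by positivity)
  rw [multiplierWord_dz_eq hVd hδ hN hφ x b] at h
  simp only [blockSum_comp_blk, mul_assoc] at h
  rw [tsum_mul_left] at h
  linarith

/-- NOT IN PRINT; OUR BOOKKEEPING.  **SUP × MASS FOR THE TABLE WORD OF A BLOCK-CONSTANT GAUGE INSERTION**: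
`|Σ'_u Σ_κ dz (ψ ∘ blk N) κ u·W u x (inl κ) b| ≤ N^{d+1}·B·Σ'_y |codiff₁ (κ y ↦ (G∘W)(N•y) x (inr κ) b) y|`. -/
theorem abs_tableWord_dz_blk_le [NeZero N] {ρ : Fin (d + 1) → ℤ} {G W : MKer (d + 1) (Fib d)}
    (hG : RelInv G (bhK N) (axEc ρ N)) (hGs : Spr G) (hWs : Spr W) {ψ : Form0 (d + 1) ℝ} {B : ℝ} (hψ : ∀ y, |ψ y| ≤ B)
    (x : Fin (d + 1) → ℤ) (b : Fib d) :
    |∑' u, ∑ κ, dz (fun v => ψ (blk N v)) κ u * W u x (Sum.inl κ) b|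
      ≤ ((N : ℝ) ^ (d + 1)) * (B * ∑' y, |codiff₁ (fun κ y => comp G W ((N : ℤ) • y) x (Sum.inr κ) b) y|) := by
  have hN : 1 ≤ N := one_le_of_neZero N
  obtain ⟨C, δ, hδ, hVd⟩ := spr_comp hGs hWs
  rw [ward_pairing_dz_blk hG hGs hWs hψ x b, abs_neg, abs_mul, abs_of_nonneg (by positivity : (0 : ℝ) ≤ (N : ℝ) ^ (d + 1))]
  refine mul_le_mul_of_nonneg_left ?_ (by positivity)
  have hs : Summable fun y => |codiff₁ (fun κ y => comp G W ((N : ℤ) • y) x (Sum.inr κ) b) y| :=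
    summable_abs_codiff₁ (fun κ => summable_abs_col_zsmul hVd hδ hN x (Sum.inr κ) b)
  have hb := tsum_of_norm_bounded (hs.mul_left B).hasSum
    (f := fun y => ψ y * codiff₁ (fun κ y => comp G W ((N : ℤ) • y) x (Sum.inr κ) b) y) (fun y => by
    rw [Real.norm_eq_abs, abs_mul]
    exact mul_le_mul_of_nonneg_right (hψ y) (abs_nonneg _))
  rw [Real.norm_eq_abs, tsum_mul_left] at hb
  exact hb

/-- NOT IN PRINT; OUR BOOKKEEPING.  **THE INSTANCE `G₀ = coDressKBmAt (toSite r) Lc (KInvStep Lc 0)`** (an2 gen 13's `relInv_coDressKBmAt_KInvStep_zero` +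
`spr_coDressKBmAt` BY NAME, as in leaf-06's `ward_pairing_coDressKBmAt_KInvStep_zero`): every in-block root `r`, every spread `W`, every bounded coarse `ψ`. -/
theorem ward_pairing_dz_blk_coDressKBmAt_KInvStep_zero {Lc : ℕ} [NeZero Lc] {r : Fin (d + 1) → ℕ} (hr : r ∈ box (d + 1) Lc)
    {W : MKer (d + 1) (Fib d)} (hWs : Spr W) {ψ : Form0 (d + 1) ℝ} {B : ℝ} (hψ : ∀ y, |ψ y| ≤ B) (x : Fin (d + 1) → ℤ) (b : Fib d) :
    ∑' u, ∑ κ, dz (fun v => ψ (blk Lc v)) κ u * W u x (Sum.inl κ) b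
      = -(((Lc : ℝ) ^ (d + 1)) * ∑' y, ψ y *
          codiff₁ (fun κ y => comp (coDressKBmAt (toSite r) Lc (KInvStep (d := d) Lc 0)) W ((Lc : ℤ) • y) x (Sum.inr κ) b) y) :=
  ward_pairing_dz_blk (relInv_coDressKBmAt_KInvStep_zero hr) (spr_coDressKBmAt (one_le_of_neZero Lc) hr
    (by obtain ⟨δ, C, hδ, -, h⟩ := OneStepKernelFamily.decays_KInvStep (d := d) (Lc := Lc) 0; exact ⟨C, δ, hδ, h⟩)) hWs hψ x b

end BlockConstant

/-! ## §5 The law: the multiplier column's coarse codifferential is the block mean of the table column's fine codifferential -/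

section Law

variable {N : ℕ}

/-- [folklore] The gauge of the lifted indicator of ONE block read against a fine 1-form `w` is the BLOCK SUM of `codiff₁ w` over that block
(finite support; `dz (𝟙_{y₀} ∘ blk N) κ u = 𝟙[blk N (u+e_κ) = y₀] − 𝟙[blk N u = y₀]` is an2's `KernelWardRelative.gaugeWt N y₀ κ u`):
`Σ'_u Σ_κ dz (𝟙_{y₀} ∘ blk N) κ u·w κ u = blockSum N (codiff₁ w) y₀`. -/
theorem tsum_dz_blockInd_mul_eq_blockSum_codiff₁ (hN : 1 ≤ N) (y₀ : Fin (d + 1) → ℤ) (w : Form1 (d + 1) ℝ) :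
    ∑' u, ∑ κ, dz (fun v => if blk N v = y₀ then (1 : ℝ) else 0) κ u * w κ u = blockSum N (codiff₁ w) y₀ := by
  classical
  -- the block indicator against any function is the finite block sum
  have hfin : ∀ f : (Fin (d + 1) → ℤ) → ℝ, ∑' u, (if blk N u = y₀ then (1 : ℝ) else 0) * f u = ∑ v ∈ box (d + 1) N, f ((N : ℤ) • y₀ + toSite v) := by
    intro f
    rw [tsum_eq_sum (s := (box (d + 1) N).image (fun v => (N : ℤ) • y₀ + toSite v)) (fun u hu => ?_)]
    · rw [Finset.sum_image (fun v _ v' _ h => AxialProjector.toSite_injective (add_left_cancel h))]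
      refine Finset.sum_congr rfl fun v hv => ?_
      rw [if_pos (blk_block y₀ hv), one_mul]
    · have hb : blk N u ≠ y₀ := by
        intro hb
        apply hu
        rw [Finset.mem_image]
        exact ⟨AveragingContours.off N u, AveragingContours.off_mem_box hN u, by rw [← hb, AveragingContours.blk_add_off hN u]⟩
      rw [if_neg hb, zero_mul]
  have hsf : ∀ f : (Fin (d + 1) → ℤ) → ℝ, Summable fun u => (if blk N u = y₀ then (1 : ℝ) else 0) * f u := by
    intro f
    refine summable_of_ne_finset_zero (s := (box (d + 1) N).image (fun v => (N : ℤ) • y₀ + toSite v)) (fun u hu => ?_)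
    have hb : blk N u ≠ y₀ := by
      intro hb
      apply hu
      rw [Finset.mem_image]
      exact ⟨AveragingContours.off N u, AveragingContours.off_mem_box hN u, by rw [← hb, AveragingContours.blk_add_off hN u]⟩
    rw [if_neg hb, zero_mul]
  -- shifted indicator: `u ↦ 𝟙[blk (u + e_κ) = y₀]·w κ u` summed = `Σ'_v 𝟙[blk v = y₀]·w κ (v − e_κ)`
  have hshift : ∀ κ, ∑' u, (if blk N (u + unitVec κ) = y₀ then (1 : ℝ) else 0) * w κ u
      = ∑' v, (if blk N v = y₀ then (1 : ℝ) else 0) * w κ (v - unitVec κ) := by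
    intro κ
    rw [← (Equiv.subRight (unitVec κ)).tsum_eq (fun u => (if blk N (u + unitVec κ) = y₀ then (1 : ℝ) else 0) * w κ u)]
    exact tsum_congr fun v => by simp
  have hsf' : ∀ κ, Summable fun u => (if blk N (u + unitVec κ) = y₀ then (1 : ℝ) else 0) * w κ u := by
    intro κ
    have h := (Equiv.addRight (unitVec κ)).summable_iff.2 (hsf (fun v => w κ (v - unitVec κ)))
    refine h.congr fun u => ?_
    simp
  calc ∑' u, ∑ κ, dz (fun v => if blk N v = y₀ then (1 : ℝ) else 0) κ u * w κ u
      = ∑' u, ∑ κ, ((if blk N (u + unitVec κ) = y₀ then (1 : ℝ) else 0) * w κ u - (if blk N u = y₀ then (1 : ℝ) else 0) * w κ u) := by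
        refine tsum_congr fun u => Finset.sum_congr rfl fun κ _ => ?_
        simp only [AffineAveraging.dz, sub_mul]
    _ = ∑ κ, ((∑' u, (if blk N (u + unitVec κ) = y₀ then (1 : ℝ) else 0) * w κ u) - ∑' u, (if blk N u = y₀ then (1 : ℝ) else 0) * w κ u) := by
        rw [Summable.tsum_finsetSum (fun κ _ => (hsf' κ).sub (hsf _))]
        exact Finset.sum_congr rfl fun κ _ => (hsf' κ).tsum_sub (hsf _)
    _ = ∑ κ, ∑ v ∈ box (d + 1) N, (w κ ((N : ℤ) • y₀ + toSite v - unitVec κ) - w κ ((N : ℤ) • y₀ + toSite v)) := by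
        refine Finset.sum_congr rfl fun κ _ => ?_
        rw [hshift κ, hfin (fun v => w κ (v - unitVec κ)), hfin (fun v => w κ v), ← Finset.sum_sub_distrib]
    _ = blockSum N (codiff₁ w) y₀ := by
        rw [Finset.sum_comm]
        simp only [AffineAveraging.blockSum, AffineAveraging.codiff₁]

/-- NOT IN PRINT; OUR BOOKKEEPING (§4 at the indicator potential `ψ := 𝟙_{y₀}` ⨾ the previous lemma).  **THE LAW — THE COARSE CODIFFERENTIAL OF THE RELATIVE INVERSE's
MULTIPLIER COLUMN IS (MINUS) THE BLOCK MEAN OF THE TABLE COLUMN's FINE CODIFFERENTIAL**: `RelInv G (bhK N) (axEc ρ N)`, `G`, `W` spread ⟹ for every block `y₀` and column `(x, b)`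
`N^{d+1}·codiff₁ (κ y ↦ (G∘W)(N•y) x (inr κ) b) y₀ = −blockSum N (codiff₁ (κ u ↦ W u x (inl κ) b)) y₀` — EXACT; the field rows of the bordered Hessian (`fieldRow_eq_of_relInv`)
read through the fine codifferential, the comb rows absorbed by the block sum.  This is the count Q-g30-1 asked for, in closed form: the multiplier column is EXACTLY AS
COARSE-SMOOTH AS THE TABLE COLUMN IS CO-CLOSED ON AVERAGE over a block. -/
theorem pow_mul_codiff₁_multiplierCol_eq [NeZero N] {ρ : Fin (d + 1) → ℤ} {G W : MKer (d + 1) (Fib d)}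
    (hG : RelInv G (bhK N) (axEc ρ N)) (hGs : Spr G) (hWs : Spr W) (y₀ x : Fin (d + 1) → ℤ) (b : Fib d) :
    ((N : ℝ) ^ (d + 1)) * codiff₁ (fun κ y => comp G W ((N : ℤ) • y) x (Sum.inr κ) b) y₀
      = -blockSum N (codiff₁ (fun κ u => W u x (Sum.inl κ) b)) y₀ := by
  classical
  have hN : 1 ≤ N := one_le_of_neZero N
  have hψ : ∀ y : Fin (d + 1) → ℤ, |(if y = y₀ then (1 : ℝ) else 0)| ≤ 1 := fun y => by split <;> simp
  have h := ward_pairing_dz_blk hG hGs hWs hψ x b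
  rw [tsum_dz_blockInd_mul_eq_blockSum_codiff₁ hN y₀ (fun κ u => W u x (Sum.inl κ) b)] at h
  rw [tsum_eq_single y₀ (fun y hy => by rw [if_neg hy, zero_mul]), if_pos rfl, one_mul] at h
  linarith

/-- NOT IN PRINT; OUR BOOKKEEPING.  **COROLLARY — CO-CLOSED TABLE COLUMN ⟹ COARSE-CO-CLOSED MULTIPLIER COLUMN ⟹ THE MULTIPLIER WORD OF EVERY PURE GAUGE VANISHES**:
if `codiff₁ (κ u ↦ W u x (inl κ) b) = 0` then for every potential `φ` with bounded block sums `Σ'_y Σ_κ contourSum N (dz φ) κ y·(G∘W)(N•y) x (inr κ) b = 0`. -/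
theorem multiplierWord_dz_eq_zero_of_coclosed [NeZero N] {ρ : Fin (d + 1) → ℤ} {G W : MKer (d + 1) (Fib d)}
    (hG : RelInv G (bhK N) (axEc ρ N)) (hGs : Spr G) (hWs : Spr W) {x : Fin (d + 1) → ℤ} {b : Fib d}
    (hco : codiff₁ (fun κ u => W u x (Sum.inl κ) b) = 0) {φ : Form0 (d + 1) ℝ} {B : ℝ} (hφ : ∀ y, |blockSum N φ y| ≤ B) :
    ∑' y, ∑ κ, contourSum N (dz φ) κ y * comp G W ((N : ℤ) • y) x (Sum.inr κ) b = 0 := by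
  have hN : 1 ≤ N := one_le_of_neZero N
  obtain ⟨C, δ, hδ, hVd⟩ := spr_comp hGs hWs
  have hcd : ∀ y, codiff₁ (fun κ y => comp G W ((N : ℤ) • y) x (Sum.inr κ) b) y = 0 := by
    intro y
    have h := pow_mul_codiff₁_multiplierCol_eq hG hGs hWs y x b
    rw [hco] at h
    simp only [AffineAveraging.blockSum, Pi.zero_apply, Finset.sum_const_zero, neg_zero, mul_eq_zero] at h
    rcases h with h | h
    · exact absurd (pow_eq_zero_iff (Nat.succ_ne_zero d) |>.1 h) (by exact_mod_cast Nat.one_le_iff_ne_zero.1 hN)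
    · exact h
  rw [multiplierWord_dz_eq hVd hδ hN hφ x b]
  have hz : (fun y => blockSum N φ y * codiff₁ (fun κ y => comp G W ((N : ℤ) • y) x (Sum.inr κ) b) y) = fun _ => 0 := by
    funext y; rw [hcd y, mul_zero]
  rw [hz, tsum_zero]

/-- NOT IN PRINT; OUR BOOKKEEPING.  **COROLLARY — THE COUNT IN ℓ¹**: `N^{d+1}·|codiff₁ (multiplier column) y₀| ≤ Σ_{v ∈ box N} |codiff₁ (table column) (N•y₀ + v)|`
(the block mean never exceeds the block's ℓ¹-mass; with §2 the multiplier word of a pure gauge is `≤ sup|block sums of φ|·N^{−(d+1)}·‖codiff₁ W^F_{x,b}‖_{ℓ¹}`). -/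
theorem pow_mul_abs_codiff₁_multiplierCol_le [NeZero N] {ρ : Fin (d + 1) → ℤ} {G W : MKer (d + 1) (Fib d)}
    (hG : RelInv G (bhK N) (axEc ρ N)) (hGs : Spr G) (hWs : Spr W) (y₀ x : Fin (d + 1) → ℤ) (b : Fib d) :
    ((N : ℝ) ^ (d + 1)) * |codiff₁ (fun κ y => comp G W ((N : ℤ) • y) x (Sum.inr κ) b) y₀|
      ≤ ∑ v ∈ box (d + 1) N, |codiff₁ (fun κ u => W u x (Sum.inl κ) b) ((N : ℤ) • y₀ + toSite v)| := by
  have h := pow_mul_codiff₁_multiplierCol_eq hG hGs hWs y₀ x b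
  have e : ((N : ℝ) ^ (d + 1)) * |codiff₁ (fun κ y => comp G W ((N : ℤ) • y) x (Sum.inr κ) b) y₀|
      = |((N : ℝ) ^ (d + 1)) * codiff₁ (fun κ y => comp G W ((N : ℤ) • y) x (Sum.inr κ) b) y₀| := by
    rw [abs_mul, abs_of_nonneg (by positivity : (0 : ℝ) ≤ (N : ℝ) ^ (d + 1))]
  rw [e, h, abs_neg]
  exact Finset.abs_sum_le_sum_abs _ _

end Law

end Summit.QuantumFields.BalabanUV.Beta.GAN24.WardPairingCoarse

end
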